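/-
Copyright: the b2b-balaban T⁴-continuum CRUX team, row NE7b leaf lineage `t4-ne7b-formalise-leaf-01` (gen 81). Project licence.
-/
import Summits.QuantumFields.BalabanUV.T4Continuum.Spine.NE7b.ConvexWindowVirial
import Mathlib.Analysis.Calculus.LocalExtr.Basic
import Mathlib.Analysis.Convex.Measure

/-!
# THE CONSTRAINED MINIMISER ON A CONVEX WINDOW AND THE `hcrit`-FREE CENTRING LETTER: argmin over a compact convex `K`, its
# variational inequality, the SHIFT `λ‖x⋆ − x₀‖ ≤ ‖∇V x₀‖` from any `x₀ ∈ K`, the window minimum `≥ V x₀ − ‖∇V x₀‖²∕(2λ)`, and the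
# windowed second moment about ANY `x₀ ∈ K`: `λ∫_K ‖y − x₀‖² e^{−V} ≤ (2n + ‖∇V x₀‖²∕λ)·∫_K e^{−V}` — NO variational letter at `x₀`
# (row NE7b, node U5c; the windowed convexity road's centring letter at a NON-critical centre; kernel lemmas of real analysis)

Cell `pub-balaban`, sub-cell `t4`, spine estimate NE7b (`T4WeightBudget.RelWeightBound`; the cell's OWN estimate — NOT PRINTED in
[Bałaban 1983–89], NOT PROVED).  Crux-route work under `Spine/NE7b/` by a row leaf on the OWNER's windowed convexity road
(`…ConvexWindowVirial`, `…ConvexWindowSuppliers`, `…ConvexWindowBrascampLieb`); NOTHING of Bałaban's is named or asserted; no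
`T4Continuum/Support` leaf typed; no `def`; zero `sorry`.

WHY.  The OWNER's virial file `…ConvexWindowVirial` (v2, §4–§5) turns the road's first-order letter ON the window `K`
(`hV : V x + ⟪∇V x, y − x⟫ + (λ∕2)‖y − x‖² ≤ V y` for `x, y ∈ K`) into the CENTRING letter `λ∫_K ‖y − x₀‖² e^{−V} ≤ n∫_K e^{−V}`
under ONE more displayed hypothesis, the variational letter `hcrit : ∀ y ∈ K, 0 ≤ ⟪∇V x₀, y − x₀⟫` at the centre.  The pricing desk located
(PRICING-NE7b v88 F461 κ-ne7bref-g73-1; v89 F464) that at the intended expansion point `hcrit` FAILS as typed — print keeps the linear term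
and bounds it additively — and booked two [folklore] lines that finish the re-centring (v89 σ-ne7bref-g74-1): (α) the argmin `x⋆` of `V`
over the compact convex window EXISTS and satisfies `hcrit` as a variational inequality; (β) the SHIFT `‖x⋆ − x₀‖ ≤ ‖∇V x₀‖∕λ`.  THIS FILE
types (α) and (β), and — more directly — removes `hcrit` altogether: adding the letter at `(x₀, y)` and `(y, x₀)` gives
`λ‖y − x₀‖² + ⟪∇V x₀, y − x₀⟫ ≤ DV(y)[y − x₀]` WITHOUT any sign information at `x₀`, so the OWNER's general-centre virial inequality
(`…ConvexWindowVirial.setIntegral_fderiv_apply_sub_mul_exp_neg_le`, v2 §5) yields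
`λ∫_K ‖y − x₀‖² e^{−V} ≤ n∫_K e^{−V} + ‖∇V x₀‖·∫_K ‖y − x₀‖ e^{−V}` and, by Young, `≤ (2n + ‖∇V x₀‖²∕λ)·∫_K e^{−V}`: the centring
letter about a NON-critical centre costs the additive `‖∇V x₀‖²∕λ` and a factor `2`, nothing else (at `∇V x₀ = 0` the raw form is the
OWNER's).  No argmin, no compactness and no closedness of `K` is needed for this END; (α)∕(β) are supplied separately for consumers who
prefer to centre AT the constrained minimiser (there `hcrit` HOLDS, and the OWNER's §5 applies verbatim).

WHAT IS PROVED ([folklore] real analysis ∕ measure theory; Mathlib + the OWNER's `…ConvexWindowVirial` BY NAME):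
* §1 `inner_gradient_sub_nonneg_of_isMinOn` — at a minimiser of ANY `V` over a CONVEX `K` the variational inequality
  `0 ≤ ⟪∇V x⋆, y − x⋆⟫` holds on `K` (Mathlib's Fermat-on-the-positive-tangent-cone if `V` is differentiable at `x⋆`; else `∇V x⋆` is
  the junk value `0`); **`exists_isMinOn_inner_gradient_sub_nonneg`** — (α): on a compact convex nonempty window a continuous `V` has a
  minimiser obeying it.
* §2 under the letter ON `K`: `norm_sub_sq_add_inner_le_fderiv_apply` (the `hcrit`-free pointwise letter), **`mul_norm_sub_le_norm_gradient`**
  — (β): `λ‖x⋆ − x₀‖ ≤ ‖∇V x₀‖` for `x⋆ ∈ K` obeying the VI and any `x₀ ∈ K` (`norm_sub_le_norm_gradient_div`: `‖x⋆ − x₀‖ ≤ ‖∇V x₀‖∕λ`),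
  `eq_of_inner_gradient_sub_nonneg` (two VI points coincide), `lowerPinch_of_inner_gradient_sub_nonneg`
  (`V x⋆ + (λ∕2)‖y − x⋆‖² ≤ V y` on `K`), **`sub_le_of_firstOrderOn`** (`V x₀ − ‖∇V x₀‖²∕(2λ) ≤ V y` on `K`: the window minimum against
  the value at the expansion point), `exists_argmin_package` (all of it at once on a compact convex window).
* §3 **`setIntegral_norm_sub_sq_mul_exp_neg_add_inner_le`** (raw: `λ∫‖y − x₀‖²e^{−V} + ∫⟪∇V x₀, y − x₀⟫e^{−V} ≤ n∫e^{−V}`),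
  **`setIntegral_norm_sub_sq_mul_exp_neg_le_add`** (`… ≤ n∫e^{−V} + ‖∇V x₀‖∫‖y − x₀‖e^{−V}`),
  **`setIntegral_norm_sub_sq_mul_exp_neg_le_of_gradient`** (`λ∫_K ‖y − x₀‖² e^{−V} ≤ (2n + ‖∇V x₀‖²∕λ)·∫_K e^{−V}`, `λ > 0`),
  `setIntegral_norm_sub_sq_mul_exp_neg_le_at_argmin` (centred AT the argmin of a compact convex window: the OWNER's `n`, no `hcrit`).
* §4 closure bookkeeping (non-closed windows): `firstOrderOn_closure` (the letter ON `K` ⟹ ON `closure K` for `V ∈ C¹`),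
  `setIntegral_closure_eq_of_convex` (`∫_{closure K} = ∫_K` for convex `K`: the frontier is Lebesgue-null),
  `setIntegral_norm_sub_sq_mul_exp_neg_le_at_argmin_closure` (§3's argmin-centred form for `K` convex BOUNDED only, argmin in `closure K`,
  integrals over `K`).
The TILTED forms (`∫‖y − x₀‖² dν_{V,K} ≤ (2n + ‖∇V x₀‖²∕λ)∕λ`, `‖∫y dν_{V,K} − x₀‖² ≤ …`, `|∫⟪u, y − x₀⟫ dν_{V,K}| ≤ ‖u‖√(…)`, and the
`x₀ = 0` drop-in shapes of the OWNER's `integral_norm_sq_windowTilted_le` ∕ `abs_windowTiltedMean_inner_le` WITHOUT `hcrit`) are the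
companion `…NE7b.ConvexWindowMinimiserTilted` (split off for the 400-line bound).

NOT HERE (honest): the value of `‖∇V x₀‖` at print's expansion point (the pricing desk's corridor letter, κ-ne7bref-g73-1 — a
HYPOTHESIS PLACEMENT of the R-step statement; by its F464 arithmetic `‖∇V x₀‖ ≤ 10^{−56.7}` in chart units once that letter pays, so the
additive term is nil BY VALUE — not valued here); the identification of `K`, `V`, `λ` with Bałaban's one-step objects ((A1c)∕(A3));
unbounded windows; anything of Bałaban's.  NE7b NOT PRINTED ∕ NOT PROVED; spine PROVED 0∕9; rung (B)+1 on a FINITE torus — NOT infinite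
volume, NOT the mass gap, NOT Clay.
HONEST DEPENDENCY: continuum YM on T⁴ ⇐ BetaPertH ∧ nine spine estimates (0/9 proved); BetaPertH ⇐ (D1) ∧ (D4) ∧ CAP+tail; G-an2-4
gates asym, D1 and NE2/3/4.
-/

set_option autoImplicit false

noncomputable section

open MeasureTheory Real Set Filter Topology Metric InnerProductSpace
open scoped RealInnerProductSpace

namespace Summit.QuantumFields.BalabanUV.T4Continuum.NE7b.ConvexWindowMinimiser

open Summit.QuantumFields.BalabanUV.T4Continuum.NE7b.ConvexWindowVirial (integrableOn_of_isBounded inner_gradient_eq_fderiv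
  setIntegral_fderiv_apply_sub_mul_exp_neg_le setIntegral_norm_sub_sq_mul_exp_neg_le)

variable {n : ℕ}

/-! ## §1 The constrained minimiser on a convex window: the variational inequality, existence -/

/-- **THE VARIATIONAL INEQUALITY AT A CONSTRAINED MINIMISER.**  If `x⋆ ∈ K` minimises `V` over a CONVEX set `K`, then
`0 ≤ ⟪∇V x⋆, y − x⋆⟫` for every `y ∈ K` — for ANY `V` (Fermat on the positive tangent cone, which contains `y − x⋆` by convexity,
when `V` is differentiable at `x⋆`; otherwise Mathlib's `gradient` is the junk value `0`). [folklore] -/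
theorem inner_gradient_sub_nonneg_of_isMinOn {V : EuclideanSpace ℝ (Fin n) → ℝ} {K : Set (EuclideanSpace ℝ (Fin n))}
    (hK : Convex ℝ K) {xs : EuclideanSpace ℝ (Fin n)} (hxs : xs ∈ K) (hmin : IsMinOn V K xs)
    {y : EuclideanSpace ℝ (Fin n)} (hy : y ∈ K) : 0 ≤ ⟪gradient V xs, y - xs⟫ := by
  by_cases hd : DifferentiableAt ℝ V xs
  · rw [inner_gradient_eq_fderiv]
    exact hmin.localize.hasFDerivWithinAt_nonneg hd.hasFDerivAt.hasFDerivWithinAt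
      (sub_mem_posTangentConeAt_of_segment_subset (hK.segment_subset hxs hy))
  · rw [gradient_eq_zero_of_not_differentiableAt hd, inner_zero_left]

/-- **(α) THE ARGMIN ON A COMPACT CONVEX WINDOW EXISTS AND OBEYS THE VARIATIONAL INEQUALITY**: `K` convex, compact, nonempty, `V`
continuous on `K` ⟹ `∃ x⋆ ∈ K` minimising `V` on `K` with `0 ≤ ⟪∇V x⋆, y − x⋆⟫` for all `y ∈ K` (the OWNER's `hcrit` at the centre `x⋆`).
[folklore] -/
theorem exists_isMinOn_inner_gradient_sub_nonneg {V : EuclideanSpace ℝ (Fin n) → ℝ} {K : Set (EuclideanSpace ℝ (Fin n))}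
    (hK : Convex ℝ K) (hKc : IsCompact K) (hKne : K.Nonempty) (hVc : ContinuousOn V K) :
    ∃ xs ∈ K, IsMinOn V K xs ∧ ∀ y ∈ K, 0 ≤ ⟪gradient V xs, y - xs⟫ := by
  obtain ⟨xs, hxs, hmin⟩ := hKc.exists_isMinOn hKne hVc
  exact ⟨xs, hxs, hmin, fun y hy => inner_gradient_sub_nonneg_of_isMinOn hK hxs hmin hy⟩

/-! ## §2 Under the road's first-order letter ON `K`: the `hcrit`-free pointwise letter, the shift, uniqueness, the pinches -/

/-- **THE `hcrit`-FREE POINTWISE LETTER.**  From the first-order letter ON `K` at `(x₀, y)` and at `(y, x₀)`: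
`λ‖y − x₀‖² + ⟪∇V x₀, y − x₀⟫ ≤ DV(y)[y − x₀]` for `x₀, y ∈ K` — no sign information at `x₀` is used. [folklore] -/
theorem norm_sub_sq_add_inner_le_fderiv_apply {V : EuclideanSpace ℝ (Fin n) → ℝ} {lam : ℝ}
    {K : Set (EuclideanSpace ℝ (Fin n))} {x₀ : EuclideanSpace ℝ (Fin n)} (hx₀ : x₀ ∈ K)
    (hV : ∀ x ∈ K, ∀ y ∈ K, V x + ⟪gradient V x, y - x⟫ + lam / 2 * ‖y - x‖ ^ 2 ≤ V y)
    {y : EuclideanSpace ℝ (Fin n)} (hy : y ∈ K) :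
    lam * ‖y - x₀‖ ^ 2 + ⟪gradient V x₀, y - x₀⟫ ≤ fderiv ℝ V y (y - x₀) := by
  have h1 := hV x₀ hx₀ y hy
  have h2 := hV y hy x₀ hx₀
  have e1 : x₀ - y = -(y - x₀) := by abel
  rw [e1, inner_neg_right, norm_neg, inner_gradient_eq_fderiv] at h2
  linarith

/-- **(β) THE SHIFT.**  If `x⋆ ∈ K` obeys the variational inequality on `K` (e.g. the argmin of §1) and `V` satisfies the first-order
`λ`-convexity letter ON `K`, then for every `x₀ ∈ K`: `λ·‖x⋆ − x₀‖ ≤ ‖∇V x₀‖` (add the letter at `(x⋆, x₀)` and `(x₀, x⋆)`, drop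
`⟪∇V x⋆, x₀ − x⋆⟫ ≥ 0`, Cauchy–Schwarz).  No sign of `λ` is needed. [folklore] -/
theorem mul_norm_sub_le_norm_gradient {V : EuclideanSpace ℝ (Fin n) → ℝ} {lam : ℝ} {K : Set (EuclideanSpace ℝ (Fin n))}
    {xs x₀ : EuclideanSpace ℝ (Fin n)} (hxs : xs ∈ K) (hx₀ : x₀ ∈ K)
    (hV : ∀ x ∈ K, ∀ y ∈ K, V x + ⟪gradient V x, y - x⟫ + lam / 2 * ‖y - x‖ ^ 2 ≤ V y)
    (hvi : ∀ y ∈ K, 0 ≤ ⟪gradient V xs, y - xs⟫) :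
    lam * ‖xs - x₀‖ ≤ ‖gradient V x₀‖ := by
  have h1 := hV x₀ hx₀ xs hxs
  have h2 := hV xs hxs x₀ hx₀
  have h3 := hvi x₀ hx₀
  rw [norm_sub_rev x₀ xs] at h2
  have hcs : -⟪gradient V x₀, xs - x₀⟫ ≤ ‖gradient V x₀‖ * ‖xs - x₀‖ := by
    have ha := abs_real_inner_le_norm (gradient V x₀) (xs - x₀)
    have hb := neg_le_abs (⟪gradient V x₀, xs - x₀⟫)
    linarith
  have hkey : lam * ‖xs - x₀‖ ^ 2 ≤ ‖gradient V x₀‖ * ‖xs - x₀‖ := by linarith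
  by_cases h0 : ‖xs - x₀‖ = 0
  · rw [h0, mul_zero]
    exact norm_nonneg _
  · have hpos : 0 < ‖xs - x₀‖ := (norm_nonneg _).lt_of_ne (Ne.symm h0)
    have h4 : lam * ‖xs - x₀‖ * ‖xs - x₀‖ ≤ ‖gradient V x₀‖ * ‖xs - x₀‖ := by
      rw [mul_assoc, ← sq]
      exact hkey
    exact le_of_mul_le_mul_right h4 hpos

/-- (β) with `λ > 0`: `‖x⋆ − x₀‖ ≤ ‖∇V x₀‖ ∕ λ`. [folklore] -/
theorem norm_sub_le_norm_gradient_div {V : EuclideanSpace ℝ (Fin n) → ℝ} {lam : ℝ} {K : Set (EuclideanSpace ℝ (Fin n))}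
    {xs x₀ : EuclideanSpace ℝ (Fin n)} (hlam : 0 < lam) (hxs : xs ∈ K) (hx₀ : x₀ ∈ K)
    (hV : ∀ x ∈ K, ∀ y ∈ K, V x + ⟪gradient V x, y - x⟫ + lam / 2 * ‖y - x‖ ^ 2 ≤ V y)
    (hvi : ∀ y ∈ K, 0 ≤ ⟪gradient V xs, y - xs⟫) :
    ‖xs - x₀‖ ≤ ‖gradient V x₀‖ / lam := by
  rw [le_div_iff₀ hlam, mul_comm]
  exact mul_norm_sub_le_norm_gradient hxs hx₀ hV hvi

/-- **UNIQUENESS**: two points of `K` obeying the variational inequality coincide (`λ > 0`). [folklore] -/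
theorem eq_of_inner_gradient_sub_nonneg {V : EuclideanSpace ℝ (Fin n) → ℝ} {lam : ℝ} {K : Set (EuclideanSpace ℝ (Fin n))}
    {x₁ x₂ : EuclideanSpace ℝ (Fin n)} (hlam : 0 < lam) (hx₁ : x₁ ∈ K) (hx₂ : x₂ ∈ K)
    (hV : ∀ x ∈ K, ∀ y ∈ K, V x + ⟪gradient V x, y - x⟫ + lam / 2 * ‖y - x‖ ^ 2 ≤ V y)
    (hvi₁ : ∀ y ∈ K, 0 ≤ ⟪gradient V x₁, y - x₁⟫) (hvi₂ : ∀ y ∈ K, 0 ≤ ⟪gradient V x₂, y - x₂⟫) : x₁ = x₂ := by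
  have h1 := hV x₁ hx₁ x₂ hx₂
  have h2 := hV x₂ hx₂ x₁ hx₁
  have h3 := hvi₁ x₂ hx₂
  have h4 := hvi₂ x₁ hx₁
  rw [norm_sub_rev x₁ x₂] at h2
  have hsq : lam * ‖x₂ - x₁‖ ^ 2 ≤ 0 := by linarith
  have hz : ‖x₂ - x₁‖ ^ 2 ≤ 0 := by
    by_contra hc
    exact absurd hsq (not_le.2 (mul_pos hlam (not_le.1 hc)))
  have hz' : ‖x₂ - x₁‖ = 0 := by nlinarith [norm_nonneg (x₂ - x₁), sq_nonneg ‖x₂ - x₁‖]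
  exact (sub_eq_zero.1 (norm_eq_zero.1 hz')).symm

/-- **THE WINDOWED LOWER PINCH AT THE CONSTRAINED MINIMISER**: the letter at `x⋆` plus the variational inequality give
`V x⋆ + (λ∕2)‖y − x⋆‖² ≤ V y` on `K`. [folklore] -/
theorem lowerPinch_of_inner_gradient_sub_nonneg {V : EuclideanSpace ℝ (Fin n) → ℝ} {lam : ℝ} {K : Set (EuclideanSpace ℝ (Fin n))}
    {xs : EuclideanSpace ℝ (Fin n)} (hxs : xs ∈ K)
    (hV : ∀ x ∈ K, ∀ y ∈ K, V x + ⟪gradient V x, y - x⟫ + lam / 2 * ‖y - x‖ ^ 2 ≤ V y)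
    (hvi : ∀ y ∈ K, 0 ≤ ⟪gradient V xs, y - xs⟫) {y : EuclideanSpace ℝ (Fin n)} (hy : y ∈ K) :
    V xs + lam / 2 * ‖y - xs‖ ^ 2 ≤ V y := by
  have h1 := hV xs hxs y hy
  have h2 := hvi y hy
  linarith

/-- **THE WINDOW MINIMUM AGAINST THE VALUE AT THE EXPANSION POINT**: under the letter ON `K` with `λ > 0`, for `x₀, y ∈ K`:
`V x₀ − ‖∇V x₀‖²∕(2λ) ≤ V y` — the linear term is absorbed by the quadratic gain (`(λ‖y − x₀‖ − ‖∇V x₀‖)² ≥ 0`); no variational letter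
at `x₀`. [folklore] -/
theorem sub_le_of_firstOrderOn {V : EuclideanSpace ℝ (Fin n) → ℝ} {lam : ℝ} {K : Set (EuclideanSpace ℝ (Fin n))}
    {x₀ : EuclideanSpace ℝ (Fin n)} (hlam : 0 < lam) (hx₀ : x₀ ∈ K)
    (hV : ∀ x ∈ K, ∀ y ∈ K, V x + ⟪gradient V x, y - x⟫ + lam / 2 * ‖y - x‖ ^ 2 ≤ V y)
    {y : EuclideanSpace ℝ (Fin n)} (hy : y ∈ K) :
    V x₀ - ‖gradient V x₀‖ ^ 2 / (2 * lam) ≤ V y := by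
  have h1 := hV x₀ hx₀ y hy
  have hcs : -(‖gradient V x₀‖ * ‖y - x₀‖) ≤ ⟪gradient V x₀, y - x₀⟫ := by
    have ha := abs_real_inner_le_norm (gradient V x₀) (y - x₀)
    have hb := neg_abs_le (⟪gradient V x₀, y - x₀⟫)
    linarith
  have hl : lam ≠ 0 := hlam.ne'
  have key : -(‖gradient V x₀‖ * ‖y - x₀‖) + lam / 2 * ‖y - x₀‖ ^ 2 + ‖gradient V x₀‖ ^ 2 / (2 * lam) =
      (lam * ‖y - x₀‖ - ‖gradient V x₀‖) ^ 2 / (2 * lam) := by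
    field_simp
    ring
  have hnn : 0 ≤ (lam * ‖y - x₀‖ - ‖gradient V x₀‖) ^ 2 / (2 * lam) := div_nonneg (sq_nonneg _) (by linarith)
  linarith

/-- **THE ARGMIN PACKAGE ON A COMPACT CONVEX WINDOW** ((α) + (β) + the pinch, at once): `K` convex compact, `x₀ ∈ K`, `V` continuous on
`K` with the first-order `λ`-convexity letter ON `K`: there is `x⋆ ∈ K` minimising `V` on `K`, obeying the variational inequality, the
lower pinch `V x⋆ + (λ∕2)‖y − x⋆‖² ≤ V y` on `K`, and the shift `λ‖x⋆ − x₀‖ ≤ ‖∇V x₀‖`. [folklore] -/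
theorem exists_argmin_package {V : EuclideanSpace ℝ (Fin n) → ℝ} {lam : ℝ} {K : Set (EuclideanSpace ℝ (Fin n))}
    (hK : Convex ℝ K) (hKc : IsCompact K) {x₀ : EuclideanSpace ℝ (Fin n)} (hx₀ : x₀ ∈ K) (hVc : ContinuousOn V K)
    (hV : ∀ x ∈ K, ∀ y ∈ K, V x + ⟪gradient V x, y - x⟫ + lam / 2 * ‖y - x‖ ^ 2 ≤ V y) :
    ∃ xs ∈ K, IsMinOn V K xs ∧ (∀ y ∈ K, 0 ≤ ⟪gradient V xs, y - xs⟫) ∧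
      (∀ y ∈ K, V xs + lam / 2 * ‖y - xs‖ ^ 2 ≤ V y) ∧ lam * ‖xs - x₀‖ ≤ ‖gradient V x₀‖ := by
  obtain ⟨xs, hxs, hmin, hvi⟩ := exists_isMinOn_inner_gradient_sub_nonneg hK hKc ⟨x₀, hx₀⟩ hVc
  exact ⟨xs, hxs, hmin, hvi, fun y hy => lowerPinch_of_inner_gradient_sub_nonneg hxs hV hvi hy,
    mul_norm_sub_le_norm_gradient hxs hx₀ hV hvi⟩

/-! ## §3 The `hcrit`-free windowed second moment about any `x₀ ∈ K` -/

/-- **RAW FORM.**  `K` convex, bounded, measurable, `x₀ ∈ K`; `V ∈ C¹`, `λ`-uniformly convex ON `K` (first-order letter between points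
of `K`) — NO variational letter at `x₀`: `λ·∫_K ‖y − x₀‖² e^{−V} + ∫_K ⟪∇V x₀, y − x₀⟫ e^{−V} ≤ n·∫_K e^{−V}` (the OWNER's general-centre
virial inequality `…ConvexWindowVirial.setIntegral_fderiv_apply_sub_mul_exp_neg_le` BY NAME, against the `hcrit`-free pointwise letter).
[folklore] -/
theorem setIntegral_norm_sub_sq_mul_exp_neg_add_inner_le {V : EuclideanSpace ℝ (Fin n) → ℝ} {lam : ℝ}
    {K : Set (EuclideanSpace ℝ (Fin n))} (hK : Convex ℝ K) (hKm : MeasurableSet K) (hKb : Bornology.IsBounded K)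
    {x₀ : EuclideanSpace ℝ (Fin n)} (hx₀ : x₀ ∈ K) (hV1 : ContDiff ℝ 1 V)
    (hV : ∀ x ∈ K, ∀ y ∈ K, V x + ⟪gradient V x, y - x⟫ + lam / 2 * ‖y - x‖ ^ 2 ≤ V y) :
    lam * (∫ y in K, ‖y - x₀‖ ^ 2 * exp (-V y)) + (∫ y in K, ⟪gradient V x₀, y - x₀⟫ * exp (-V y)) ≤
      (n : ℝ) * ∫ y in K, exp (-V y) := by
  have hDc : Continuous (fderiv ℝ V) := hV1.continuous_fderiv one_ne_zero
  have hI1 : IntegrableOn (fun y : EuclideanSpace ℝ (Fin n) => ‖y - x₀‖ ^ 2 * exp (-V y)) K :=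
    integrableOn_of_isBounded hKb (((continuous_id.sub continuous_const).norm.pow 2).mul hV1.continuous.neg.rexp)
  have hI3 : IntegrableOn (fun y : EuclideanSpace ℝ (Fin n) => ⟪gradient V x₀, y - x₀⟫ * exp (-V y)) K :=
    integrableOn_of_isBounded hKb
      ((continuous_const.inner (continuous_id.sub continuous_const)).mul hV1.continuous.neg.rexp)
  have hI2 : IntegrableOn (fun y : EuclideanSpace ℝ (Fin n) => fderiv ℝ V y (y - x₀) * exp (-V y)) K :=
    integrableOn_of_isBounded hKb ((hDc.clm_apply (continuous_id.sub continuous_const)).mul hV1.continuous.neg.rexp)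
  have hS : IntegrableOn (fun y : EuclideanSpace ℝ (Fin n) =>
      lam * (‖y - x₀‖ ^ 2 * exp (-V y)) + ⟪gradient V x₀, y - x₀⟫ * exp (-V y)) K := (hI1.const_mul lam).add hI3
  refine le_trans ?_ (setIntegral_fderiv_apply_sub_mul_exp_neg_le hK hKm hKb hx₀ hV1)
  rw [← integral_const_mul, ← integral_add (hI1.const_mul lam) hI3]
  refine setIntegral_mono_on hS hI2 hKm fun y hy => ?_
  have h := norm_sub_sq_add_inner_le_fderiv_apply hx₀ hV hy
  have he := exp_pos (-V y)
  calc lam * (‖y - x₀‖ ^ 2 * exp (-V y)) + ⟪gradient V x₀, y - x₀⟫ * exp (-V y)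
        = (lam * ‖y - x₀‖ ^ 2 + ⟪gradient V x₀, y - x₀⟫) * exp (-V y) := by ring
    _ ≤ fderiv ℝ V y (y - x₀) * exp (-V y) := mul_le_mul_of_nonneg_right h he.le

/-- **THE `hcrit`-FREE WINDOWED SECOND MOMENT, CAUCHY–SCHWARZ FORM**: under the hypotheses of
`setIntegral_norm_sub_sq_mul_exp_neg_add_inner_le`: `λ·∫_K ‖y − x₀‖² e^{−V} ≤ n·∫_K e^{−V} + ‖∇V x₀‖·∫_K ‖y − x₀‖ e^{−V}`.  At a centre
with `∇V x₀ = 0` this is the OWNER's `setIntegral_norm_sub_sq_mul_exp_neg_le` with `hcrit` discharged. [folklore] -/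
theorem setIntegral_norm_sub_sq_mul_exp_neg_le_add {V : EuclideanSpace ℝ (Fin n) → ℝ} {lam : ℝ}
    {K : Set (EuclideanSpace ℝ (Fin n))} (hK : Convex ℝ K) (hKm : MeasurableSet K) (hKb : Bornology.IsBounded K)
    {x₀ : EuclideanSpace ℝ (Fin n)} (hx₀ : x₀ ∈ K) (hV1 : ContDiff ℝ 1 V)
    (hV : ∀ x ∈ K, ∀ y ∈ K, V x + ⟪gradient V x, y - x⟫ + lam / 2 * ‖y - x‖ ^ 2 ≤ V y) :
    lam * ∫ y in K, ‖y - x₀‖ ^ 2 * exp (-V y) ≤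
      (n : ℝ) * (∫ y in K, exp (-V y)) + ‖gradient V x₀‖ * ∫ y in K, ‖y - x₀‖ * exp (-V y) := by
  have h := setIntegral_norm_sub_sq_mul_exp_neg_add_inner_le hK hKm hKb hx₀ hV1 hV
  have hI3 : IntegrableOn (fun y : EuclideanSpace ℝ (Fin n) => ⟪gradient V x₀, y - x₀⟫ * exp (-V y)) K :=
    integrableOn_of_isBounded hKb
      ((continuous_const.inner (continuous_id.sub continuous_const)).mul hV1.continuous.neg.rexp)
  have hI4 : IntegrableOn (fun y : EuclideanSpace ℝ (Fin n) => ‖y - x₀‖ * exp (-V y)) K :=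
    integrableOn_of_isBounded hKb ((continuous_id.sub continuous_const).norm.mul hV1.continuous.neg.rexp)
  have hb : -(∫ y in K, ⟪gradient V x₀, y - x₀⟫ * exp (-V y)) ≤ ‖gradient V x₀‖ * ∫ y in K, ‖y - x₀‖ * exp (-V y) := by
    rw [← integral_neg, ← integral_const_mul]
    refine setIntegral_mono_on hI3.neg (hI4.const_mul _) hKm fun y hy => ?_
    have he := exp_pos (-V y)
    have hcs : -⟪gradient V x₀, y - x₀⟫ ≤ ‖gradient V x₀‖ * ‖y - x₀‖ := by
      have ha := abs_real_inner_le_norm (gradient V x₀) (y - x₀)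
      have hb' := neg_le_abs (⟪gradient V x₀, y - x₀⟫)
      linarith
    calc -(⟪gradient V x₀, y - x₀⟫ * exp (-V y)) = (-⟪gradient V x₀, y - x₀⟫) * exp (-V y) := by ring
      _ ≤ (‖gradient V x₀‖ * ‖y - x₀‖) * exp (-V y) := mul_le_mul_of_nonneg_right hcs he.le
      _ = ‖gradient V x₀‖ * (‖y - x₀‖ * exp (-V y)) := by ring
  linarith

/-- **THE `hcrit`-FREE WINDOWED SECOND MOMENT.**  `K` convex, bounded, measurable, `x₀ ∈ K`; `V ∈ C¹`, `λ`-uniformly convex ON `K`,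
`λ > 0`; NO variational letter at `x₀`: `λ·∫_K ‖y − x₀‖² e^{−V} ≤ (2n + ‖∇V x₀‖²∕λ)·∫_K e^{−V}` (the Cauchy–Schwarz form plus Young
`‖∇V x₀‖·r ≤ (λ∕2)r² + ‖∇V x₀‖²∕(2λ)`).  The centring letter about a NON-critical centre: additive `‖∇V x₀‖²∕λ`, factor `2` on `n`.
[folklore] -/
theorem setIntegral_norm_sub_sq_mul_exp_neg_le_of_gradient {V : EuclideanSpace ℝ (Fin n) → ℝ} {lam : ℝ}
    {K : Set (EuclideanSpace ℝ (Fin n))} (hlam : 0 < lam) (hK : Convex ℝ K) (hKm : MeasurableSet K)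
    (hKb : Bornology.IsBounded K) {x₀ : EuclideanSpace ℝ (Fin n)} (hx₀ : x₀ ∈ K) (hV1 : ContDiff ℝ 1 V)
    (hV : ∀ x ∈ K, ∀ y ∈ K, V x + ⟪gradient V x, y - x⟫ + lam / 2 * ‖y - x‖ ^ 2 ≤ V y) :
    lam * ∫ y in K, ‖y - x₀‖ ^ 2 * exp (-V y) ≤ (2 * n + ‖gradient V x₀‖ ^ 2 / lam) * ∫ y in K, exp (-V y) := by
  set G : ℝ := ‖gradient V x₀‖ with hG
  have hl : lam ≠ 0 := hlam.ne'
  have hI1 : IntegrableOn (fun y : EuclideanSpace ℝ (Fin n) => ‖y - x₀‖ ^ 2 * exp (-V y)) K :=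
    integrableOn_of_isBounded hKb (((continuous_id.sub continuous_const).norm.pow 2).mul hV1.continuous.neg.rexp)
  have hI4 : IntegrableOn (fun y : EuclideanSpace ℝ (Fin n) => ‖y - x₀‖ * exp (-V y)) K :=
    integrableOn_of_isBounded hKb ((continuous_id.sub continuous_const).norm.mul hV1.continuous.neg.rexp)
  have hZ : IntegrableOn (fun y : EuclideanSpace ℝ (Fin n) => exp (-V y)) K :=
    integrableOn_of_isBounded hKb hV1.continuous.neg.rexp
  -- Young, integrated: `G·∫ r e^{−V} ≤ (λ∕2)·∫ r² e^{−V} + G²∕(2λ)·∫ e^{−V}`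
  have hpt : ∀ y ∈ K, G * (‖y - x₀‖ * exp (-V y)) ≤
      lam / 2 * (‖y - x₀‖ ^ 2 * exp (-V y)) + G ^ 2 / (2 * lam) * exp (-V y) := fun y _ => by
    have he := exp_pos (-V y)
    have key : lam / 2 * ‖y - x₀‖ ^ 2 + G ^ 2 / (2 * lam) - G * ‖y - x₀‖ = (lam * ‖y - x₀‖ - G) ^ 2 / (2 * lam) := by
      field_simp
      ring
    have hnn : 0 ≤ (lam * ‖y - x₀‖ - G) ^ 2 / (2 * lam) := div_nonneg (sq_nonneg _) (by linarith)
    have hy' : G * ‖y - x₀‖ ≤ lam / 2 * ‖y - x₀‖ ^ 2 + G ^ 2 / (2 * lam) := by linarith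
    calc G * (‖y - x₀‖ * exp (-V y)) = (G * ‖y - x₀‖) * exp (-V y) := by ring
      _ ≤ (lam / 2 * ‖y - x₀‖ ^ 2 + G ^ 2 / (2 * lam)) * exp (-V y) := mul_le_mul_of_nonneg_right hy' he.le
      _ = lam / 2 * (‖y - x₀‖ ^ 2 * exp (-V y)) + G ^ 2 / (2 * lam) * exp (-V y) := by ring
  have hS : IntegrableOn (fun y : EuclideanSpace ℝ (Fin n) =>
      lam / 2 * (‖y - x₀‖ ^ 2 * exp (-V y)) + G ^ 2 / (2 * lam) * exp (-V y)) K :=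
    (hI1.const_mul (lam / 2)).add (hZ.const_mul (G ^ 2 / (2 * lam)))
  have hY : G * (∫ y in K, ‖y - x₀‖ * exp (-V y)) ≤
      lam / 2 * (∫ y in K, ‖y - x₀‖ ^ 2 * exp (-V y)) + G ^ 2 / (2 * lam) * ∫ y in K, exp (-V y) := by
    calc G * (∫ y in K, ‖y - x₀‖ * exp (-V y)) = ∫ y in K, G * (‖y - x₀‖ * exp (-V y)) := (integral_const_mul _ _).symm
      _ ≤ ∫ y in K, (lam / 2 * (‖y - x₀‖ ^ 2 * exp (-V y)) + G ^ 2 / (2 * lam) * exp (-V y)) :=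
          setIntegral_mono_on (hI4.const_mul G) hS hKm hpt
      _ = lam / 2 * (∫ y in K, ‖y - x₀‖ ^ 2 * exp (-V y)) + G ^ 2 / (2 * lam) * ∫ y in K, exp (-V y) := by
          rw [integral_add (hI1.const_mul (lam / 2)) (hZ.const_mul (G ^ 2 / (2 * lam))), integral_const_mul,
            integral_const_mul]
  have h := setIntegral_norm_sub_sq_mul_exp_neg_le_add hK hKm hKb hx₀ hV1 hV
  have e2 : (2 * n + G ^ 2 / lam) * (∫ y in K, exp (-V y)) =
      2 * ((n : ℝ) * (∫ y in K, exp (-V y)) + G ^ 2 / (2 * lam) * ∫ y in K, exp (-V y)) := by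
    ring
  rw [e2]
  linarith

/-- **CENTRED AT THE ARGMIN** (composition of §1 with the OWNER's §5): `K` convex and COMPACT, `x₀ ∈ K`; `V ∈ C¹`, `λ`-uniformly convex ON
`K`: there is `x⋆ ∈ K` minimising `V` on `K` with `λ·∫_K ‖y − x⋆‖² e^{−V} ≤ n·∫_K e^{−V}` (the OWNER's constant, `hcrit` discharged by the
variational inequality) and `λ‖x⋆ − x₀‖ ≤ ‖∇V x₀‖`. [folklore] -/
theorem setIntegral_norm_sub_sq_mul_exp_neg_le_at_argmin {V : EuclideanSpace ℝ (Fin n) → ℝ} {lam : ℝ}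
    {K : Set (EuclideanSpace ℝ (Fin n))} (hK : Convex ℝ K) (hKc : IsCompact K) {x₀ : EuclideanSpace ℝ (Fin n)} (hx₀ : x₀ ∈ K)
    (hV1 : ContDiff ℝ 1 V) (hV : ∀ x ∈ K, ∀ y ∈ K, V x + ⟪gradient V x, y - x⟫ + lam / 2 * ‖y - x‖ ^ 2 ≤ V y) :
    ∃ xs ∈ K, IsMinOn V K xs ∧ (lam * ∫ y in K, ‖y - xs‖ ^ 2 * exp (-V y) ≤ (n : ℝ) * ∫ y in K, exp (-V y)) ∧
      lam * ‖xs - x₀‖ ≤ ‖gradient V x₀‖ := by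
  obtain ⟨xs, hxs, hmin, hvi⟩ := exists_isMinOn_inner_gradient_sub_nonneg hK hKc ⟨x₀, hx₀⟩ hV1.continuous.continuousOn
  exact ⟨xs, hxs, hmin, setIntegral_norm_sub_sq_mul_exp_neg_le hK hKc.measurableSet hKc.isBounded hxs hV1 hV hvi,
    mul_norm_sub_le_norm_gradient hxs hx₀ hV hvi⟩

/-! ## §4 Closure bookkeeping: the letter and the window integrals pass to `closure K` (non-closed windows) -/

/-- **THE FIRST-ORDER LETTER EXTENDS TO THE CLOSURE**: for `V ∈ C¹` the road's letter ON `K` holds ON `closure K` (both sides are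
continuous in `(x, y)` and the letter is a closed condition). So print's open windows `|B′(b)| < δ` and their closures carry the same
letter. [folklore] -/
theorem firstOrderOn_closure {V : EuclideanSpace ℝ (Fin n) → ℝ} {lam : ℝ} {K : Set (EuclideanSpace ℝ (Fin n))}
    (hV1 : ContDiff ℝ 1 V) (hV : ∀ x ∈ K, ∀ y ∈ K, V x + ⟪gradient V x, y - x⟫ + lam / 2 * ‖y - x‖ ^ 2 ≤ V y) :
    ∀ x ∈ closure K, ∀ y ∈ closure K, V x + ⟪gradient V x, y - x⟫ + lam / 2 * ‖y - x‖ ^ 2 ≤ V y := by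
  have hVc : Continuous V := hV1.continuous
  have hgc : Continuous (gradient V) :=
    (InnerProductSpace.toDual ℝ (EuclideanSpace ℝ (Fin n))).symm.continuous.comp (hV1.continuous_fderiv one_ne_zero)
  set F : EuclideanSpace ℝ (Fin n) × EuclideanSpace ℝ (Fin n) → ℝ :=
    fun p => V p.2 - (V p.1 + ⟪gradient V p.1, p.2 - p.1⟫ + lam / 2 * ‖p.2 - p.1‖ ^ 2) with hF
  have hFc : Continuous F := by
    have h1 : Continuous fun p : EuclideanSpace ℝ (Fin n) × EuclideanSpace ℝ (Fin n) => ⟪gradient V p.1, p.2 - p.1⟫ :=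
      (hgc.comp continuous_fst).inner (continuous_snd.sub continuous_fst)
    have h2 : Continuous fun p : EuclideanSpace ℝ (Fin n) × EuclideanSpace ℝ (Fin n) => lam / 2 * ‖p.2 - p.1‖ ^ 2 :=
      continuous_const.mul ((continuous_snd.sub continuous_fst).norm.pow 2)
    exact (hVc.comp continuous_snd).sub (((hVc.comp continuous_fst).add h1).add h2)
  have hS : IsClosed {p : EuclideanSpace ℝ (Fin n) × EuclideanSpace ℝ (Fin n) | 0 ≤ F p} :=
    isClosed_le continuous_const hFc
  have hsub : K ×ˢ K ⊆ {p | 0 ≤ F p} := fun p hp => by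
    have h := hV p.1 hp.1 p.2 hp.2
    show 0 ≤ F p
    rw [hF]
    linarith
  have hcl : closure K ×ˢ closure K ⊆ {p | 0 ≤ F p} := by
    rw [← closure_prod_eq]
    exact closure_minimal hsub hS
  intro x hx y hy
  have h : 0 ≤ F (x, y) := hcl (Set.mk_mem_prod hx hy)
  rw [hF] at h
  simp only at h
  linarith

/-- **WINDOW INTEGRALS IGNORE THE BOUNDARY**: for a CONVEX `K` (finite dimension, Lebesgue measure) the frontier is null
(`Convex.addHaar_frontier`), so `∫_{closure K} f = ∫_K f`. [folklore] -/
theorem setIntegral_closure_eq_of_convex {K : Set (EuclideanSpace ℝ (Fin n))} (hK : Convex ℝ K)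
    (f : EuclideanSpace ℝ (Fin n) → ℝ) : ∫ y in closure K, f y = ∫ y in K, f y := by
  have h1 : closure K \ K ⊆ frontier K := fun y hy => ⟨hy.1, fun h => hy.2 (interior_subset h)⟩
  have h2 : K \ closure K ⊆ (∅ : Set (EuclideanSpace ℝ (Fin n))) := fun y hy => absurd (subset_closure hy.1) hy.2
  refine setIntegral_congr_set ((ae_eq_set).2 ⟨?_, ?_⟩)
  · exact measure_mono_null h1 (hK.addHaar_frontier volume)
  · exact measure_mono_null h2 measure_empty

/-- **CENTRED AT THE ARGMIN OVER THE CLOSURE** (non-closed windows): `K` convex and BOUNDED (not necessarily closed), `x₀ ∈ K`; `V ∈ C¹`,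
`λ`-uniformly convex ON `K`: there is `x⋆ ∈ closure K` minimising `V` on `closure K` with
`λ·∫_K ‖y − x⋆‖² e^{−V} ≤ n·∫_K e^{−V}` (integrals over `K` itself — the frontier is null) and `λ‖x⋆ − x₀‖ ≤ ‖∇V x₀‖` (the pricing
desk's «take `K` closed — measure-zero bookkeeping», v89 F464 σ-ne7bref-g74-1 (α), as a lemma). [folklore] -/
theorem setIntegral_norm_sub_sq_mul_exp_neg_le_at_argmin_closure {V : EuclideanSpace ℝ (Fin n) → ℝ} {lam : ℝ}
    {K : Set (EuclideanSpace ℝ (Fin n))} (hK : Convex ℝ K) (hKb : Bornology.IsBounded K) {x₀ : EuclideanSpace ℝ (Fin n)}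
    (hx₀ : x₀ ∈ K) (hV1 : ContDiff ℝ 1 V)
    (hV : ∀ x ∈ K, ∀ y ∈ K, V x + ⟪gradient V x, y - x⟫ + lam / 2 * ‖y - x‖ ^ 2 ≤ V y) :
    ∃ xs ∈ closure K, IsMinOn V (closure K) xs ∧
      (lam * ∫ y in K, ‖y - xs‖ ^ 2 * exp (-V y) ≤ (n : ℝ) * ∫ y in K, exp (-V y)) ∧ lam * ‖xs - x₀‖ ≤ ‖gradient V x₀‖ := by
  obtain ⟨xs, hxs, hmin, hI, hshift⟩ := setIntegral_norm_sub_sq_mul_exp_neg_le_at_argmin hK.closure hKb.isCompact_closure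
    (subset_closure hx₀) hV1 (firstOrderOn_closure hV1 hV)
  refine ⟨xs, hxs, hmin, ?_, hshift⟩
  rwa [setIntegral_closure_eq_of_convex hK, setIntegral_closure_eq_of_convex hK] at hI

end Summit.QuantumFields.BalabanUV.T4Continuum.NE7b.ConvexWindowMinimiser

end
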